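import Summits.Ventures.CertifiedArithmetic.LowPrec.DoubleRoundingProductSameQuantum
import Summits.Ventures.CertifiedArithmetic.LowPrec.DoubleRoundingProductWindowConverse

/-!
# Double rounding at equal quanta: the fine zone is innocuous

HONEST FRAMING (venture CertifiedArithmetic / cell `pub-lowprec`): certified error envelopes and
provably optimal rounding/accumulation schemes for low-precision formats under stated cost models;
every table by two implementations; no hardware or vendor claims.

ONE GRID INSIDE ANOTHER, low part.  Two formats `φ`, `ψ` with the SAME quantum `q`
(`L_ψ = L_φ`) both hold every multiple of `q` below `2^(m+1)·q` (`m` the smaller trailing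
significand width, here `m_φ`; `ψ` at least up to the same magnitude).  For `x = (c·2^u + r)·q/2^u`
(`u ≥ 1`, `r < 2^u`) with `c + 1 ≤ 2^(m_φ+1)` in range of both, `fl_φ (fl_ψ x) = fl_φ x`
(`sameQ_roundNE_roundNE_low`, §2): both roundings pick the nearest of the consecutive values
`c q`, `(c+1) q`, and at the tie `r = 2^(u-1)` both pick the EVEN multiple — below `2^(m+1)` the
parity of the trailing significand is the parity of the multiple in either format
(`two_dvd_man_iff`).  This is the zone `K < 2^(m+1+u)` of the decision
`DoubleRoundingProductSameQuantumLaw.lean`; §1 has the two helpers it needs at the top of the zone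
(`c + 1 = 2^(m+1)` allowed: `representable_of_le_pow`, `toRat_roundNE_half_of_odd_le`).
Two implementations: A = `code/enum/mul_sameq_decision.py` (exact-rational brute force of the
composite rounding on pseudo-records at `d = 0`) → `certs/enum/DOUBLE-ROUNDING-MUL-SAMEQ-LAW.json`;
B = this file (structural, every record).
PLACEMENT — KNOWN / folklore: double rounding is innocuous where the intermediate format holds
the final candidates and shares the tie rule's parity ([Figueroa1995] §2; [MullerEtAl2018]
§3.3.1).  Nothing new is claimed here beyond the record-generic Lean statement.
No hardware or vendor claims.
-/

namespace Summit.Ventures.CertifiedArithmetic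

open Literature.ComputerArithmetic.FloatingPoint
open Literature.ComputerArithmetic.FloatingPoint.Format
open Literature.ComputerArithmetic.FloatingPoint.MiniFloat

/-! ## §1 Helpers: the top of the fine zone -/

/-- Magnitudes `n ≤ 2^(m+1)` in range are representable (`2^(m+1) = 2^m·2`). [folklore] -/
theorem representable_of_le_pow {φ : Format} {n : ℕ} (hn : n ≤ 2 ^ (φ.manBits + 1))
    (hle : n ≤ φ.maxScaled) : φ.Representable n := by
  rcases lt_or_eq_of_le hn with h | h
  · exact representable_of_lt_pow h hle
  · have hpow : 2 ^ (φ.manBits + 1) = 2 ^ φ.manBits * 2 ^ 1 := by rw [pow_one, pow_succ]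
    have h0 : 0 < 2 ^ φ.manBits := by positivity
    rw [h, hpow]
    exact representable_mul_pow (by rw [pow_succ]; omega) (by rw [← hpow, ← h]; exact hle)

/-- TIES-TO-EVEN AT A HALF-INTEGER, ODD LOWER NEIGHBOUR, up to the top of the fine zone: for
`m ≥ 1`, odd `j` with `j + 1 ≤ 2^(m+1)` and `j + 1 ≤ M_φ`, `fl_φ ((j + 1/2)·q) = (j + 1)·q`
(`toRat_roundNE_half_of_odd` with `j + 1 = 2^(m+1)` allowed). [folklore] -/
theorem toRat_roundNE_half_of_odd_le {φ : Format} (h1 : 1 ≤ φ.manBits) {j : ℕ} (hj : Odd j)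
    (hj1 : j + 1 ≤ 2 ^ (φ.manBits + 1)) (hju : j + 1 ≤ φ.maxScaled) :
    (roundNE φ (((2 * j + 1 : ℕ) : ℚ) / 2 * φ.quantum)).toRat = ((j + 1 : ℕ) : ℚ) * φ.quantum := by
  have hq := φ.quantum_pos
  obtain ⟨z1, hz1⟩ := exists_toRat_eq_natMul (representable_of_le_pow (φ := φ) hj1 hju)
  set x := ((2 * j + 1 : ℕ) : ℚ) / 2 * φ.quantum with hx
  have ex1 : x - z1.toRat = -(φ.quantum / 2) := by rw [hx, hz1]; push_cast; ring
  have hnear := roundNE_nearest (φ := φ) x z1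
  rw [ex1, abs_neg, abs_of_pos (half_pos hq)] at hnear
  obtain ⟨T, hT⟩ := exists_toRat_eq_int_mul (roundNE φ x)
  have hTj : T = j ∨ T = j + 1 := by
    rw [hT] at hnear
    have e1 : x - (T : ℚ) * φ.quantum = (((2 * j + 1 : ℕ) : ℚ) / 2 - T) * φ.quantum := by
      rw [hx]; ring
    rw [e1, abs_mul, abs_of_pos hq] at hnear
    have h' : |((2 * j + 1 : ℕ) : ℚ) / 2 - T| ≤ 1 / 2 := by
      by_contra hc; push Not at hc; nlinarith
    rw [abs_le] at h'; push_cast at h'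
    have hlo : (j : ℚ) ≤ T := by linarith [h'.2]
    have hhi : (T : ℚ) ≤ j + 1 := by linarith [h'.1]
    have hlo' : (j : ℤ) ≤ T := by exact_mod_cast hlo
    have hhi' : T ≤ (j : ℤ) + 1 := by exact_mod_cast hhi
    omega
  rcases hTj with rfl | rfl
  · exfalso
    have hr1 : (roundNE φ x).toRat = ((j : ℕ) : ℚ) * φ.quantum := by rw [hT]; push_cast; ring
    have hev : 2 ∣ (roundNE φ x).man := by
      refine roundNE_man_even_of_tie h1 (y := z1) ?_ ?_
      · rw [ex1, hr1, show x - ((j : ℕ) : ℚ) * φ.quantum = φ.quantum / 2 by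
          rw [hx]; push_cast; ring, abs_neg]
      · rw [hz1, hr1]; push_cast
        intro h; have := mul_right_cancel₀ hq.ne' h; linarith
    rw [two_dvd_man_iff h1, scaledMag_eq_of_toRat_eq hr1] at hev
    have h2 : 2 ∣ j := dvd_trans (Dvd.intro _ rfl) hev
    obtain ⟨c, hc⟩ := hj
    omega
  · rw [hT]; push_cast; ring

/-! ## §2 The fine zone is innocuous -/

/-- THE LOW ZONE IS INNOCUOUS (`L_ψ = L_φ`, `m_φ, m_ψ ≥ 1`): for `x = (c·2^u + r)·q/2^u`, `u ≥ 1`,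
`r < 2^u`, `c + 1 ≤ 2^(m_φ+1)` (so `c q`, `(c+1) q` are consecutive values of `φ`), `c + 1` in range
of both and below `2^(m_ψ+1)`: `fl_φ (fl_ψ x) = fl_φ x` — both roundings pick the nearest of
`c q`, `(c+1) q`, and at the tie `r = 2^(u-1)` both pick the even multiple. [this packet] -/
theorem sameQ_roundNE_roundNE_low {φ ψ : Format} (hq : ψ.qexp = φ.qexp) (h1 : 1 ≤ φ.manBits)
    (h1ψ : 1 ≤ ψ.manBits) {c r u : ℕ} (hu : 1 ≤ u) (hr : r < 2 ^ u)
    (hc : c + 1 ≤ 2 ^ (φ.manBits + 1)) (hcM : c + 1 ≤ φ.maxScaled)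
    (hψm : c + 1 < 2 ^ (ψ.manBits + 1)) (hψM : c + 1 ≤ ψ.maxScaled) :
    (roundNE φ (roundNE ψ (((c * 2 ^ u + r : ℕ) : ℚ) * φ.quantum / 2 ^ u)).toRat).toRat
      = (roundNE φ (((c * 2 ^ u + r : ℕ) : ℚ) * φ.quantum / 2 ^ u)).toRat := by
  have hq0 := φ.quantum_pos
  have hQ : ψ.quantum = φ.quantum := by
    show (2 : ℚ) ^ ψ.qexp = (2 : ℚ) ^ φ.qexp
    rw [hq]
  set s : ℚ := φ.quantum / 2 ^ u with hs
  have hs0 : 0 < s := by positivity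
  have hq' : φ.quantum = 2 ^ u * s := by rw [hs]; field_simp
  have hu2 : (2 : ℚ) ^ u = 2 * 2 ^ (u - 1) := by rw [← pow_succ']; congr 1; omega
  set x : ℚ := ((c * 2 ^ u + r : ℕ) : ℚ) * φ.quantum / 2 ^ u with hx
  have hxs : x = (c : ℚ) * φ.quantum + (r : ℚ) * s := by
    rw [hx, hs]; push_cast; field_simp
  have hrepc : φ.Representable c := representable_of_lt_pow (by omega) (by omega)
  have hrepc1 : φ.Representable (c + 1) := representable_of_le_pow hc hcM
  have hψc : ψ.Representable c := representable_of_lt_pow (by omega) (by omega)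
  have hψc1 : ψ.Representable (c + 1) := representable_of_lt_pow hψm hψM
  obtain ⟨zc, hzc⟩ := exists_toRat_eq_natMul hrepc
  obtain ⟨zc1, hzc1⟩ := exists_toRat_eq_natMul hrepc1
  rcases lt_trichotomy (2 * r) (2 ^ u) with hlt | heq | hgt
  · -- nearest: `c q` in both formats
    have h2r : (2 * r : ℚ) < 2 ^ u := by exact_mod_cast hlt
    have hε : 2 * |(r : ℚ) * s| < φ.quantum := by
      rw [abs_of_nonneg (by positivity), hq']
      calc 2 * ((r : ℚ) * s) = (2 * r) * s := by ring
        _ < 2 ^ u * s := mul_lt_mul_of_pos_right h2r hs0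
    have hψx : (roundNE ψ x).toRat = (c : ℚ) * φ.quantum := by
      rw [hxs, ← hQ]
      exact toRat_roundNE_natMul_add_small hψc (by rw [hQ]; exact hε)
    have hφx : (roundNE φ x).toRat = (c : ℚ) * φ.quantum := by
      rw [hxs]; exact toRat_roundNE_natMul_add_small hrepc hε
    rw [hψx, hφx, ← hzc, toRat_roundNE_toRat]
  · -- the tie `x = (c + 1/2) q`: both formats pick the even one of `c`, `c + 1`
    have h2r : (2 : ℚ) * r = 2 ^ u := by exact_mod_cast heq
    have hr' : (r : ℚ) * s = φ.quantum / 2 := by rw [hq', ← h2r]; ring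
    have hxm : x = ((2 * c + 1 : ℕ) : ℚ) / 2 * φ.quantum := by rw [hxs, hr']; push_cast; ring
    rcases Nat.even_or_odd c with hce | hco
    · have hψx : (roundNE ψ x).toRat = (c : ℚ) * φ.quantum := by
        rw [hxm, ← hQ]; exact toRat_roundNE_half_of_even h1ψ hce hψm hψM
      have hφx : (roundNE φ x).toRat = (c : ℚ) * φ.quantum := by
        rw [hxm]
        rcases lt_or_eq_of_le hc with hlt' | heq'
        · exact toRat_roundNE_half_of_even h1 hce hlt' hcM
        · exfalso
          have h2 : 2 ^ (φ.manBits + 1) % 2 = 0 := by rw [pow_succ]; exact Nat.mul_mod_left _ _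
          obtain ⟨t, ht⟩ := hce
          omega
      rw [hψx, hφx, ← hzc, toRat_roundNE_toRat]
    · have hψx : (roundNE ψ x).toRat = ((c + 1 : ℕ) : ℚ) * φ.quantum := by
        rw [hxm, ← hQ]; exact toRat_roundNE_half_of_odd h1ψ hco hψm hψM
      have hφx : (roundNE φ x).toRat = ((c + 1 : ℕ) : ℚ) * φ.quantum := by
        rw [hxm]; exact toRat_roundNE_half_of_odd_le h1 hco hc hcM
      rw [hψx, hφx, ← hzc1, toRat_roundNE_toRat]
  · -- nearest: `(c+1) q` in both formats
    have h2r : (2 : ℚ) ^ u < 2 * r := by exact_mod_cast hgt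
    have hrle : (r : ℚ) ≤ 2 ^ u := by exact_mod_cast hr.le
    have hε : 2 * |((r : ℚ) * s - φ.quantum)| < φ.quantum := by
      rw [hq', abs_of_nonpos (by nlinarith)]
      nlinarith
    have e : x = ((c + 1 : ℕ) : ℚ) * φ.quantum + ((r : ℚ) * s - φ.quantum) := by
      rw [hxs]; push_cast; ring
    have hψx : (roundNE ψ x).toRat = ((c + 1 : ℕ) : ℚ) * φ.quantum := by
      rw [e, ← hQ]
      exact toRat_roundNE_natMul_add_small hψc1 (by rw [hQ]; exact hε)
    have hφx : (roundNE φ x).toRat = ((c + 1 : ℕ) : ℚ) * φ.quantum := by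
      rw [e]; exact toRat_roundNE_natMul_add_small hrepc1 hε
    rw [hψx, hφx, ← hzc1, toRat_roundNE_toRat]

end Summit.Ventures.CertifiedArithmetic
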